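import Summits.Ventures.PercRepro.ProfilePointedCircuitClassesSevenE
import Summits.Ventures.PercRepro.ProfilePointedCircuitClassesPairFiveReduce

/-!
# PercRepro — THE PER-PAIR IN–OUT INEQUALITY AT `n = 12`, I: DEMANDS, UNITS AND THE WEIGHTED RELATION IN THE DUAL
(p5, gen 42; `proofs/P5-GM1.md` §64)

`M` is a matroid of rank `5` on `12` points (the dual of a matroid of rank `7` and nullity `5`) and `S` a pair.
DEMANDS: the bases `W ⊇ S` with `E ∖ W` spanning (`thru_5(S)` of the primal); UNITS: the spanning `6`-sets `U`
avoiding `S` with `E ∖ U` spanning (`thru_6(S)` of the primal, by complementation).  For a unit `U`, `Z := E ∖ U`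
has six points and rank `5`; `circ5(Z)` is the set of points whose removal keeps `Z` spanning (the unique circuit
of `Z`), and the demands disjoint from `U` are the sets `Z − t`, `t ∈ circ5(Z) ∖ S` — `p(U)` of them
(`filter_pdem_inter_eq_image`).  For a demand `W`, `B := E ∖ W` has seven points and the units disjoint from `W` are
the sets `B − b`, `b` a non-coloop of `B` (`filter_punit_inter_eq_image`).  THE WEIGHTS `pwt`: `12 / p(U)` on a
disjoint pair, except `3` when `circ5(Z)` is a pair avoiding `S` (a `(2,0)`-unit); `1` on a CLEAN pair
(`#(W ∩ U) = 1`, `B ∖ U = circ5(Z)`) of a `(2,0)`-unit and a DEFICIENT demand (at most three non-coloops in `B`);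
`0` otherwise.  THIS FILE: every unit receives at most `12` (`sum_pwt_le_twelve`) and every non-deficient demand
sends at least `12` (`twelve_le_sum_pwt_of_not_deficient`); the deficient demands are part II.
-/

open scoped Matroid

namespace PercRepro.Cogirth

open Finset ThmH Skew Shadow Profile

variable {α : Type} [DecidableEq α] {M : Matroid α} [M.Finite]

section PairSevenA

/-- DEMANDS in the dual: the bases `W ⊇ S` of `M` (rank `5`) with spanning complement. -/
noncomputable def pdem (M : Matroid α) [M.Finite] (S : Finset α) : Finset (Finset α) :=
  ((gr M).powersetCard 5).filter (fun W => S ⊆ W ∧ rk M W = 5 ∧ rk M (gr M \ W) = 5)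

/-- UNITS in the dual: the spanning `6`-sets `U` avoiding `S` with spanning complement. -/
noncomputable def punit (M : Matroid α) [M.Finite] (S : Finset α) : Finset (Finset α) :=
  ((gr M).powersetCard 6).filter (fun U => U ∩ S = ∅ ∧ rk M U = 5 ∧ rk M (gr M \ U) = 5)

/-- The points of `Z` whose removal keeps the rank `5` (for `Z = E ∖ U` of nullity `1`: its unique circuit). -/
noncomputable def circ5 (M : Matroid α) [M.Finite] (Z : Finset α) : Finset α :=
  Z.filter (fun t => rk M (Z.erase t) = 5)

/-- Membership in `circ5`. -/
theorem mem_circ5 {Z : Finset α} {t : α} : t ∈ circ5 M Z ↔ t ∈ Z ∧ rk M (Z.erase t) = 5 := by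
  unfold circ5
  rw [mem_filter]

/-- `p(U) = #(circ5(E ∖ U) ∖ S)`: the number of demands disjoint from the unit `U`. -/
noncomputable def pU (M : Matroid α) [M.Finite] (S U : Finset α) : ℕ := (circ5 M (gr M \ U) \ S).card

/-- The `(2,0)`-units: the circuit of `E ∖ U` is a pair avoiding `S`. -/
abbrev type20 (M : Matroid α) [M.Finite] (S U : Finset α) : Prop :=
  (circ5 M (gr M \ U)).card = 2 ∧ circ5 M (gr M \ U) ∩ S = ∅

/-- The non-coloops of `B = E ∖ W`: the units disjoint from `W` are the sets `B − b`, `b ∈ nonco(W)`. -/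
noncomputable def nonco (M : Matroid α) [M.Finite] (W : Finset α) : Finset α :=
  (gr M \ W).filter (fun b => rk M ((gr M \ W).erase b) = 5)

/-- DEFICIENT demands: at most three non-coloops in `B = E ∖ W`. -/
abbrev deficient (M : Matroid α) [M.Finite] (W : Finset α) : Prop := (nonco M W).card ≤ 3

/-- The integer weight of the pair (demand `W`, unit `U`): `12 / p(U)` on disjoint pairs (`3` for `(2,0)`-units),
`1` on clean pairs of deficient demands with `(2,0)`-units, `0` otherwise. -/
noncomputable def pwt (M : Matroid α) [M.Finite] (S W U : Finset α) : ℕ :=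
  if W ∩ U = ∅ then (if type20 M S U then 3 else 12 / pU M S U)
  else (if (W ∩ U).card = 1 ∧ (gr M \ W) \ U = circ5 M (gr M \ U) ∧ type20 M S U ∧ deficient M W then 1
    else 0)

/-- Membership in `pdem`. -/
theorem mem_pdem {S W : Finset α} :
    W ∈ pdem M S ↔ W ⊆ gr M ∧ W.card = 5 ∧ S ⊆ W ∧ rk M W = 5 ∧ rk M (gr M \ W) = 5 := by
  unfold pdem
  rw [mem_filter, mem_powersetCard]
  tauto

/-- Membership in `punit`. -/
theorem mem_punit {S U : Finset α} :
    U ∈ punit M S ↔ U ⊆ gr M ∧ U.card = 6 ∧ U ∩ S = ∅ ∧ rk M U = 5 ∧ rk M (gr M \ U) = 5 := by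
  unfold punit
  rw [mem_filter, mem_powersetCard]
  tauto

/-- `S ⊆ E ∖ U` for a unit `U` (`S ⊆ E`, `U ∩ S = ∅`). -/
theorem subset_sdiff_of_mem_punit {S U : Finset α} (hS : S ⊆ gr M) (hU : U ∈ punit M S) : S ⊆ gr M \ U := by
  rw [mem_punit] at hU
  intro s hs
  rw [mem_sdiff]
  refine ⟨hS hs, fun hsU => ?_⟩
  have : s ∈ U ∩ S := mem_inter.2 ⟨hsU, hs⟩
  rw [hU.2.2.1] at this
  exact notMem_empty s this

/-- **The demands disjoint from a unit** are the sets `Z − t`, `t ∈ circ5(Z) ∖ S`, `Z := E ∖ U`. -/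
theorem filter_pdem_inter_eq_image (hn : (gr M).card = 12) (hR : rk M (gr M) = 5) {S : Finset α} (hS : S ⊆ gr M)
    {U : Finset α} (hU : U ∈ punit M S) :
    (pdem M S).filter (fun W => W ∩ U = ∅) =
      (circ5 M (gr M \ U) \ S).image (fun t => (gr M \ U).erase t) := by
  have hSZ : S ⊆ gr M \ U := subset_sdiff_of_mem_punit hS hU
  rw [mem_punit] at hU
  obtain ⟨hUg, hU6, _, hUr, _⟩ := hU
  have hZ6 : (gr M \ U).card = 6 := by rw [card_sdiff_of_subset hUg, hn, hU6]
  ext W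
  rw [mem_filter, mem_pdem, mem_image]
  constructor
  · rintro ⟨⟨hWg, hW5, hSW, hWr, _⟩, hWU⟩
    have hWZ : W ⊆ gr M \ U := by
      intro w hw
      rw [mem_sdiff]
      refine ⟨hWg hw, fun hwU => ?_⟩
      have : w ∈ W ∩ U := mem_inter.2 ⟨hw, hwU⟩
      rw [hWU] at this
      exact notMem_empty w this
    have h1 : ((gr M \ U) \ W).card = 1 := by rw [card_sdiff_of_subset hWZ, hZ6, hW5]
    obtain ⟨t, ht⟩ := card_eq_one.1 h1
    have htZ : t ∈ gr M \ U := by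
      have : t ∈ (gr M \ U) \ W := by rw [ht]; exact mem_singleton_self t
      exact (mem_sdiff.1 this).1
    have htW : t ∉ W := by
      have : t ∈ (gr M \ U) \ W := by rw [ht]; exact mem_singleton_self t
      exact (mem_sdiff.1 this).2
    have hWe : W = (gr M \ U).erase t := by
      rw [← sdiff_singleton_eq_erase, ← ht, Finset.sdiff_sdiff_eq_self hWZ]
    refine ⟨t, ?_, hWe.symm⟩
    rw [mem_sdiff]
    refine ⟨?_, fun htS => htW (hSW htS)⟩
    unfold circ5
    rw [mem_filter]
    exact ⟨htZ, by rw [← hWe]; exact hWr⟩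
  · rintro ⟨t, ht, rfl⟩
    rw [mem_sdiff] at ht
    obtain ⟨htc, htS⟩ := ht
    unfold circ5 at htc
    rw [mem_filter] at htc
    obtain ⟨htZ, htr⟩ := htc
    have hWg : (gr M \ U).erase t ⊆ gr M := (erase_subset _ _).trans sdiff_subset
    refine ⟨⟨hWg, ?_, ?_, htr, ?_⟩, ?_⟩
    · rw [card_erase_of_mem htZ, hZ6]
    · intro s hs
      exact mem_erase.2 ⟨fun h => htS (h ▸ hs), hSZ hs⟩
    · -- `E ∖ (Z − t) = U + t` spans
      have e : gr M \ (gr M \ U).erase t = insert t U := by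
        ext a
        rw [mem_sdiff, mem_erase, mem_sdiff, mem_insert]
        constructor
        · rintro ⟨hag, h⟩
          by_cases hat : a = t
          · exact Or.inl hat
          · exact Or.inr (by_contra fun haU => h ⟨hat, hag, haU⟩)
        · rintro (rfl | haU)
          · exact ⟨(mem_sdiff.1 htZ).1, fun h => h.1 rfl⟩
          · exact ⟨hUg haU, fun h => h.2.2 haU⟩
      rw [e]
      have h1 := rk_mono' (M := M) (subset_insert t U)
      have h2 := rk_mono' (M := M) (insert_subset (mem_sdiff.1 htZ).1 hUg)
      omega
    · exact disjoint_iff_inter_eq_empty.1 (disjoint_of_subset_left (erase_subset _ _) sdiff_disjoint)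

/-- `#{demands disjoint from U} = p(U)`. -/
theorem card_filter_pdem_inter_eq (hn : (gr M).card = 12) (hR : rk M (gr M) = 5) {S : Finset α} (hS : S ⊆ gr M)
    {U : Finset α} (hU : U ∈ punit M S) :
    ((pdem M S).filter (fun W => W ∩ U = ∅)).card = pU M S U := by
  rw [filter_pdem_inter_eq_image hn hR hS hU]
  unfold pU
  apply card_image_of_injOn
  intro t ht t' ht' h
  have htZ : t ∈ gr M \ U := (mem_circ5.1 (mem_sdiff.1 (mem_coe.1 ht)).1).1
  have ht'Z : t' ∈ gr M \ U := (mem_circ5.1 (mem_sdiff.1 (mem_coe.1 ht')).1).1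
  exact (gr M \ U).erase_injOn htZ ht'Z h

/-- `p(U) ≤ 4`: `circ5(Z) ∖ S ⊆ Z ∖ S`, four points. -/
theorem pU_le_four (hn : (gr M).card = 12) {S : Finset α} (hS : S ⊆ gr M) (hS2 : S.card = 2) {U : Finset α}
    (hU : U ∈ punit M S) : pU M S U ≤ 4 := by
  have hSZ : S ⊆ gr M \ U := subset_sdiff_of_mem_punit hS hU
  rw [mem_punit] at hU
  have hZ6 : (gr M \ U).card = 6 := by rw [card_sdiff_of_subset hU.1, hn, hU.2.1]
  unfold pU
  have h : circ5 M (gr M \ U) \ S ⊆ (gr M \ U) \ S := sdiff_subset_sdiff (filter_subset _ _) (Subset.refl _)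
  have h2 := card_le_card h
  rw [card_sdiff_of_subset hSZ, hZ6, hS2] at h2
  exact h2

/-- **The units disjoint from a demand** are the sets `B − b`, `b` a non-coloop of `B := E ∖ W`. -/
theorem filter_punit_inter_eq_image (hn : (gr M).card = 12) (hR : rk M (gr M) = 5) {S : Finset α}
    {W : Finset α} (hW : W ∈ pdem M S) :
    (punit M S).filter (fun U => W ∩ U = ∅) = (nonco M W).image (fun b => (gr M \ W).erase b) := by
  rw [mem_pdem] at hW
  obtain ⟨hWg, hW5, hSW, hWr, hWc⟩ := hW
  have hB7 : (gr M \ W).card = 7 := by rw [card_sdiff_of_subset hWg, hn, hW5]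
  ext U
  rw [mem_filter, mem_punit, mem_image]
  constructor
  · rintro ⟨⟨hUg, hU6, hUS, hUr, _⟩, hWU⟩
    have hUB : U ⊆ gr M \ W := by
      intro u hu
      rw [mem_sdiff]
      refine ⟨hUg hu, fun huW => ?_⟩
      have : u ∈ W ∩ U := mem_inter.2 ⟨huW, hu⟩
      rw [hWU] at this
      exact notMem_empty u this
    have h1 : ((gr M \ W) \ U).card = 1 := by rw [card_sdiff_of_subset hUB, hB7, hU6]
    obtain ⟨b, hb⟩ := card_eq_one.1 h1
    have hbB : b ∈ gr M \ W := by
      have : b ∈ (gr M \ W) \ U := by rw [hb]; exact mem_singleton_self b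
      exact (mem_sdiff.1 this).1
    have hUe : U = (gr M \ W).erase b := by
      rw [← sdiff_singleton_eq_erase, ← hb, Finset.sdiff_sdiff_eq_self hUB]
    refine ⟨b, ?_, hUe.symm⟩
    unfold nonco
    rw [mem_filter]
    exact ⟨hbB, by rw [← hUe]; exact hUr⟩
  · rintro ⟨b, hb, rfl⟩
    unfold nonco at hb
    rw [mem_filter] at hb
    obtain ⟨hbB, hbr⟩ := hb
    have hUg : (gr M \ W).erase b ⊆ gr M := (erase_subset _ _).trans sdiff_subset
    refine ⟨⟨hUg, ?_, ?_, hbr, ?_⟩, ?_⟩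
    · rw [card_erase_of_mem hbB, hB7]
    · exact disjoint_iff_inter_eq_empty.1
        (disjoint_of_subset_left (erase_subset _ _) (disjoint_of_subset_right hSW sdiff_disjoint))
    · have e : gr M \ (gr M \ W).erase b = insert b W := by
        ext a
        rw [mem_sdiff, mem_erase, mem_sdiff, mem_insert]
        constructor
        · rintro ⟨hag, h⟩
          by_cases hab : a = b
          · exact Or.inl hab
          · exact Or.inr (by_contra fun haW => h ⟨hab, hag, haW⟩)
        · rintro (rfl | haW)
          · exact ⟨(mem_sdiff.1 hbB).1, fun h => h.1 rfl⟩
          · exact ⟨hWg haW, fun h => h.2.2 haW⟩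
      rw [e]
      have h1 := rk_mono' (M := M) (subset_insert b W)
      have h2 := rk_mono' (M := M) (insert_subset (mem_sdiff.1 hbB).1 hWg)
      omega
    · exact disjoint_iff_inter_eq_empty.1 (disjoint_of_subset_right (erase_subset _ _) sdiff_disjoint.symm)

/-- `#{units disjoint from W} = #nonco(W)`. -/
theorem card_filter_punit_inter_eq (hn : (gr M).card = 12) (hR : rk M (gr M) = 5) {S W : Finset α}
    (hW : W ∈ pdem M S) :
    ((punit M S).filter (fun U => W ∩ U = ∅)).card = (nonco M W).card := by
  rw [filter_punit_inter_eq_image hn hR hW]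
  apply card_image_of_injOn
  intro b hb b' hb' h
  have hbB : b ∈ gr M \ W := by
    have := mem_coe.1 hb
    unfold nonco at this
    exact (mem_filter.1 this).1
  have hb'B : b' ∈ gr M \ W := by
    have := mem_coe.1 hb'
    unfold nonco at this
    exact (mem_filter.1 this).1
  exact (gr M \ W).erase_injOn hbB hb'B h

/-- A `(2,0)`-unit has `p(U) = 2`. -/
theorem pU_eq_two_of_type20 {S U : Finset α} (h : type20 M S U) : pU M S U = 2 := by
  unfold pU
  have e : circ5 M (gr M \ U) \ S = circ5 M (gr M \ U) := by
    rw [Finset.sdiff_eq_self_iff_disjoint, disjoint_iff_inter_eq_empty]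
    exact h.2
  rw [e, h.1]

/-- **THE UNITS' SIDE**: every unit receives weight at most `12` — `p(U)·(12 / p(U)) ≤ 12` from the disjoint demands
(or `2·3 = 6` for a `(2,0)`-unit), and at most one clean demand per point of `U` (each weight `1`, only for
`(2,0)`-units). -/
theorem sum_pwt_le_twelve (hn : (gr M).card = 12) (hR : rk M (gr M) = 5) {S : Finset α} (hS : S ⊆ gr M)
    {U : Finset α} (hU : U ∈ punit M S) : ∑ W ∈ pdem M S, pwt M S W U ≤ 12 := by
  rw [← sum_filter_add_sum_filter_not (pdem M S) (fun W => W ∩ U = ∅)]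
  have hU6 : U.card = 6 := (mem_punit.1 hU).2.1
  -- the disjoint demands
  have h1 : ∑ W ∈ (pdem M S).filter (fun W => W ∩ U = ∅), pwt M S W U =
      (if type20 M S U then 6 else pU M S U * (12 / pU M S U)) := by
    have e : ∀ W ∈ (pdem M S).filter (fun W => W ∩ U = ∅),
        pwt M S W U = (if type20 M S U then 3 else 12 / pU M S U) := by
      intro W hW
      unfold pwt
      rw [if_pos (mem_filter.1 hW).2]
    rw [sum_congr rfl e, sum_const, card_filter_pdem_inter_eq hn hR hS hU, smul_eq_mul]
    split_ifs with h20
    · rw [pU_eq_two_of_type20 h20]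
    · rfl
  -- the clean demands
  have h2 : ∑ W ∈ (pdem M S).filter (fun W => ¬ W ∩ U = ∅), pwt M S W U ≤ (if type20 M S U then 6 else 0) := by
    have e : ∀ W ∈ (pdem M S).filter (fun W => ¬ W ∩ U = ∅), pwt M S W U =
        (if (W ∩ U).card = 1 ∧ (gr M \ W) \ U = circ5 M (gr M \ U) ∧ type20 M S U ∧ deficient M W then 1
          else 0) := by
      intro W hW
      unfold pwt
      rw [if_neg (mem_filter.1 hW).2]
    rw [sum_congr rfl e, sum_boole]
    simp only [Nat.cast_id]
    split_ifs with h20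
    · -- at most one clean demand per point of `U`: `W ↦ W ∩ U` is injective
      calc (((pdem M S).filter (fun W => ¬ W ∩ U = ∅)).filter
            (fun W => (W ∩ U).card = 1 ∧ (gr M \ W) \ U = circ5 M (gr M \ U) ∧ type20 M S U ∧
              deficient M W)).card
          ≤ (U.powersetCard 1).card := by
            apply card_le_card_of_injOn (fun W => W ∩ U)
            · intro W hW
              rw [mem_coe, mem_filter] at hW
              rw [mem_coe, mem_powersetCard]
              exact ⟨inter_subset_right, hW.2.1⟩
            · intro W₁ hW₁ W₂ hW₂ h
              rw [mem_coe, mem_filter, mem_filter] at hW₁ hW₂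
              simp only at h
              -- `W ∖ U = Z ∖ circ5(Z)` for both, so `W = (Z ∖ circ5 Z) ∪ (W ∩ U)`
              have key : ∀ W : Finset α, W ∈ pdem M S → (gr M \ W) \ U = circ5 M (gr M \ U) →
                  W = ((gr M \ U) \ circ5 M (gr M \ U)) ∪ (W ∩ U) := by
                intro W hW hcl
                have hWg : W ⊆ gr M := (mem_pdem.1 hW).1
                have hsub : W \ U ⊆ gr M \ U := sdiff_subset_sdiff hWg (Subset.refl _)
                have e1 : (gr M \ U) \ (W \ U) = (gr M \ W) \ U := by
                  ext a
                  simp only [mem_sdiff, not_and, not_not]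
                  tauto
                have e2 : W \ U = (gr M \ U) \ circ5 M (gr M \ U) := by
                  rw [← hcl, ← e1, Finset.sdiff_sdiff_eq_self hsub]
                rw [← e2, sdiff_union_inter]
              rw [key W₁ hW₁.1.1 hW₁.2.2.1, key W₂ hW₂.1.1 hW₂.2.2.1, h]
        _ = 6 := by rw [card_powersetCard, Nat.choose_one_right, hU6]
    · -- no `(2,0)`-unit: the clean condition is never met
      rw [Nat.le_zero, card_eq_zero, filter_eq_empty_iff]
      intro W _ hW
      exact h20 hW.2.2.1
  have h3 : (if type20 M S U then 6 else pU M S U * (12 / pU M S U)) +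
      (if type20 M S U then 6 else 0) ≤ 12 := by
    split_ifs
    · norm_num
    · have := Nat.mul_div_le 12 (pU M S U)
      omega
  omega

/-- Every disjoint pair carries weight at least `3` (`p(U) ∈ [1, 4]`, or the `(2,0)` weight `3`). -/
theorem three_le_pwt_of_inter_eq_empty (hn : (gr M).card = 12) (hR : rk M (gr M) = 5) {S : Finset α}
    (hS : S ⊆ gr M) (hS2 : S.card = 2) {W U : Finset α} (hW : W ∈ pdem M S) (hU : U ∈ punit M S)
    (hWU : W ∩ U = ∅) : 3 ≤ pwt M S W U := by
  unfold pwt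
  rw [if_pos hWU]
  split_ifs
  · exact le_refl _
  · have hp4 := pU_le_four hn hS hS2 hU
    have hp1 : 1 ≤ pU M S U := by
      rw [← card_filter_pdem_inter_eq hn hR hS hU]
      exact card_pos.2 ⟨W, mem_filter.2 ⟨hW, hWU⟩⟩
    interval_cases (pU M S U) <;> norm_num

/-- **THE NON-DEFICIENT DEMANDS' SIDE**: a demand with at least four non-coloops in `E ∖ W` sends at least
`4 · 3 = 12` to its disjoint units. -/
theorem twelve_le_sum_pwt_of_not_deficient (hn : (gr M).card = 12) (hR : rk M (gr M) = 5) {S : Finset α}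
    (hS : S ⊆ gr M) (hS2 : S.card = 2) {W : Finset α} (hW : W ∈ pdem M S) (hnd : ¬ deficient M W) :
    12 ≤ ∑ U ∈ punit M S, pwt M S W U := by
  have h4 : 4 ≤ (nonco M W).card := by unfold deficient at hnd; omega
  calc 12 ≤ 3 * ((punit M S).filter (fun U => W ∩ U = ∅)).card := by
          rw [card_filter_punit_inter_eq hn hR hW]; omega
    _ ≤ ∑ U ∈ (punit M S).filter (fun U => W ∩ U = ∅), pwt M S W U := by
          rw [mul_comm, ← smul_eq_mul]
          apply card_nsmul_le_sum
          intro U hU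
          rw [mem_filter] at hU
          exact three_le_pwt_of_inter_eq_empty hn hR hS hS2 hW hU.1 hU.2
    _ ≤ ∑ U ∈ punit M S, pwt M S W U := sum_le_sum_of_subset (filter_subset _ _)

end PairSevenA

end PercRepro.Cogirth
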